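import Summits.KontsevichZagierPeriods.KontsevichZagierPeriods.Theses.WeightFloor
import Summits.KontsevichZagierPeriods.KontsevichZagierPeriods.Theorems.TwoRouteTransportTriplicationGlue
import Summits.KontsevichZagierPeriods.KontsevichZagierPeriods.Theorems.CubicTransportDuplicationFamily
import Summits.KontsevichZagierPeriods.KontsevichZagierPeriods.Theorems.TerasomaMultiplicationGammaHodgeFromRelatorsChains
import Summits.KontsevichZagierPeriods.KontsevichZagierPeriods.Theorems.InverseLandauTateLiftingBandArea
import Literature.NumberTheory.Transcendental.KZBallPeelingAux
import Literature.NumberTheory.Transcendental.KZDilationMove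
import Literature.NumberTheory.Transcendental.SemialgebraicRpow

/-!
# `FermatQuarticStone` (stmt-KontsevichZagierPeriods-13936, route WeightFloor) — proof

The quartic egg `{x⁴ + y² ≤ 1}` and the Fermat stone `{x⁴ + y⁴ ≤ 8/9}`, both with integrand
`1`, are equivalent in the Kontsevich–Zagier calculus (areas
`B(1/4,3/2) = (8/9)^{1/2} B(1/4,5/4) = 4ϖ/3`). The chain, organised in the formal period ring
`P = FormalRep ⧸ relations` (`β(p,q) = ⟦[(0,1), t^{p−1}(1−t)^{q−1}]⟧`, `κ(q) = ⟦[pt, q]⟧`):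
* AREA → BETA (`toFormalPeriod_quarticStone`): a stone `{x⁴ ≤ 1, |y| ≤ (1 − x⁴)^{b−1}}` is a band
  of rule (3); ONE Newton–Leibniz move with primitive `y` (`InverseLandau.tateLifting_bandArea`)
  gives `[{x⁴ ≤ 1}, 2(1 − x⁴)^{b−1}]`, and the symmetric quartic fold (`symmetricQuartic_equivalent`:
  drop the null points `0, ±1`, split, fold `(−1,0)` onto `(0,1)` by `x ↦ −x`, merge, substitute
  `t = x⁴`) gives `β(1/4, b)`. So `⟦r⟧ = β(1/4,3/2)` and, after shrinking the Fermat stone onto the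
  unit one by the dilation `u ↦ (8/9)^{1/4} u` (rule (2), `KZ.smul_sub_mem_relations`),
  `⟦r'⟧ = κ((8/9)^{1/2})β(1/4,5/4)`.
* BETA ALGEBRA in `P` (`betaClass_quarter_threeHalves_eq`): the translations
  `κ(1/2)β(1/4,1/2) = κ(3/4)β(1/4,3/2)`, `κ(1/4)β(1/4,1/4) = κ(1/2)β(1/4,5/4)` (one
  Newton–Leibniz move each), Legendre's duplication `β(1/4,1/4) = κ(√2)β(1/2,1/4)` (the landed
  `DuplicationFamily` at `a = 1/4`), the reflection `β(1/2,1/4) = β(1/4,1/2)` and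
  `(3/4)·(8/9)^{1/2}·(1/4)·√2 = (1/2)²` give `β(1/4,3/2) = κ((8/9)^{1/2})β(1/4,5/4)`.
(lead c10 of crux 9129, banking.) References: Kontsevich–Zagier 2001 §1.2; Andrews–Askey–Roy 1999
§1.1, Thm 1.5.1.
-/

noncomputable section

open MeasureTheory Set
open Literature.NumberTheory.Transcendental Literature.NumberTheory.Transcendental.KZ
open Literature.ModelTheory.ExponentialFields (IsSemialgebraic isSemialgebraic_setOf_eval_le)
open MvPolynomial (X C aeval)
open Summit.KontsevichZagierPeriods.GammaHodgeSectorKO (betaRep betaRep_domain betaClass betaClass_eq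
  kap kap_mul kap_congr kap_mul_kap_inv)
open Summit.KontsevichZagierPeriods.TerasomaMultiplication.GammaHodgeFromRelators
  (betaClass_symm kap_mul_betaClass_eq_kap_mul_betaClass_succ isAlgebraic_ratCast)
open Summit.KontsevichZagierPeriods.TwoRouteTransport (duplication_betaClass duplicationFamily_proof
  unitIoo_eq_setOf isAlgebraic_dupConst kap_mul_toFormalPeriod)
open KZ.BallPeeling (isSemialgebraic_negIoo isSemialgebraic_posIoo volume_setOf_apply_eq_const
  of_sub_of_mem_relations_of_neg)

namespace Summit.KontsevichZagierPeriods.WeightFloor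

/-- `x⁴ ≤ 1` iff `-1 ≤ x ≤ 1`. [folklore] -/
theorem pow_four_le_one_iff (x : ℝ) : x ^ 4 ≤ 1 ↔ -1 ≤ x ∧ x ≤ 1 := by
  rw [← abs_le, ← pow_le_one_iff_of_nonneg (abs_nonneg x) (by norm_num : (4:ℕ) ≠ 0), pow_abs,
    abs_of_nonneg (by positivity)]

/-- `yⁿ ≤ c` iff `|y| ≤ c^{1/n}` (`n ≠ 0` even, `c ≥ 0`), in interval form. [folklore] -/
theorem pow_le_iff_abs_le_rpow_inv {n : ℕ} (hn : n ≠ 0) (heven : Even n) {y c : ℝ} (hc : 0 ≤ c) :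
    y ^ n ≤ c ↔ -c ^ ((n:ℝ)⁻¹) ≤ y ∧ y ≤ c ^ ((n:ℝ)⁻¹) := by
  rw [← abs_le, ← heven.pow_abs]
  refine ⟨fun h => ?_, fun h => ?_⟩
  · rw [← Real.pow_rpow_inv_natCast (abs_nonneg y) hn]
    exact Real.rpow_le_rpow (pow_nonneg (abs_nonneg y) n) h (by positivity)
  · exact (Real.rpow_inv_natCast_pow hc hn) ▸ pow_le_pow_left₀ (abs_nonneg y) h n

/-- **A stone `{x⁴ + yⁿ ≤ 1}` (`n` even) is a band**: `{x⁴ ≤ 1, |y| ≤ (1 − x⁴)^{1/n}}`, the format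
of Kontsevich–Zagier's rule (3). [folklore] -/
theorem setOf_quarticStone_eq {n : ℕ} (hn : n ≠ 0) (heven : Even n) (e : ℝ) (he : e = (n:ℝ)⁻¹) :
    {v : Fin 2 → ℝ | v 0 ^ 4 + v 1 ^ n ≤ 1} =
      {z | z 0 ^ 4 ≤ 1 ∧ -(1 - z 0 ^ 4) ^ e ≤ z 1 ∧ z 1 ≤ (1 - z 0 ^ 4) ^ e} := by
  subst he
  refine Set.ext fun v => ⟨fun h => ?_, fun ⟨h4, h⟩ => ?_⟩
  · have h' : v 0 ^ 4 + v 1 ^ n ≤ 1 ∧ 0 ≤ v 1 ^ n := ⟨h, heven.pow_nonneg _⟩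
    have h4 : v 0 ^ 4 ≤ 1 := by linarith
    exact ⟨h4, (pow_le_iff_abs_le_rpow_inv hn heven (sub_nonneg.2 h4)).1 (by linarith)⟩
  · have := (pow_le_iff_abs_le_rpow_inv hn heven (sub_nonneg.2 h4)).2 h
    show v 0 ^ 4 + v 1 ^ n ≤ 1
    linarith

/-- `((8/9)^{1/4})⁴ = 8/9`. [folklore] -/
theorem fermatConst_pow_four : (((8:ℝ)/9) ^ ((4:ℝ)⁻¹)) ^ 4 = 8/9 := by
  rw [← Real.rpow_natCast, ← Real.rpow_mul (by norm_num : (0:ℝ) ≤ 8/9)]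
  norm_num

/-- `(8/9)^{1/4}` is algebraic (its fourth power is `8/9`). [folklore] -/
theorem isAlgebraic_fermatConst : IsAlgebraic ℚ (((8:ℝ)/9) ^ ((4:ℝ)⁻¹)) := by
  have h : IsAlgebraic ℚ (((8/9:ℚ)):ℝ) := isAlgebraic_ratCast _
  push_cast at h
  exact IsAlgebraic.of_pow (by norm_num : 0 < 4) (by rwa [fermatConst_pow_four])

/-- **The constant**: `(3/4) · ((8/9)^{1/4})² · (1/4) · 2^{1−2/4} = (1/2)·(1/2)`
(`(8/9)^{1/2} · 2^{1/2} = 4/3`). [folklore] -/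
theorem const_identity :
    (((3/4:ℚ)):ℝ) * (((8:ℝ)/9) ^ ((4:ℝ)⁻¹)) ^ 2 * (((1/4:ℚ)):ℝ) * (2:ℝ) ^ (1 - 2 * ((1/4:ℚ):ℝ)) =
      (((1/2:ℚ)):ℝ) * (((1/2:ℚ)):ℝ) := by
  have e1 : (((8:ℝ)/9) ^ ((4:ℝ)⁻¹)) ^ 2 = ((8:ℝ)/9) ^ ((2:ℝ)⁻¹) := by
    rw [← Real.rpow_natCast, ← Real.rpow_mul (by norm_num : (0:ℝ) ≤ 8/9)]
    norm_num
  have e2 : (1 - 2 * ((1/4:ℚ):ℝ)) = (2:ℝ)⁻¹ := by norm_num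
  have e3 : ((8:ℝ)/9) ^ ((2:ℝ)⁻¹) * (2:ℝ) ^ ((2:ℝ)⁻¹) = 4/3 := by
    rw [← Real.mul_rpow (by norm_num) (by norm_num), show (8:ℝ)/9 * 2 = (4/3) ^ 2 by norm_num,
      show ((4:ℝ)/3) ^ 2 = ((4:ℝ)/3) ^ ((2:ℕ):ℝ) from (Real.rpow_natCast _ 2).symm,
      ← Real.rpow_mul (by norm_num : (0:ℝ) ≤ 4/3)]
    norm_num
  rw [e1, e2, show (((3/4:ℚ)):ℝ) * ((8:ℝ)/9) ^ ((2:ℝ)⁻¹) * (((1/4:ℚ)):ℝ) * (2:ℝ) ^ ((2:ℝ)⁻¹) =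
    (((3/4:ℚ)):ℝ) * (((1/4:ℚ)):ℝ) * (((8:ℝ)/9) ^ ((2:ℝ)⁻¹) * (2:ℝ) ^ ((2:ℝ)⁻¹)) by ring, e3]
  norm_num

/-! ## The symmetric quartic fold and the area of a quartic stone -/

/-- **The symmetric quartic fold**: `[{x⁴ ≤ 1}, 2(1 − x⁴)^{b−1}] ∼ [(0,1), t^{1/4−1}(1 − t)^{b−1}]`
for representations pinned by domain and integrand: remove the null points `x = 0, ±1` and split
`(−1,0) ∪ (0,1)` (rule 1a), fold `(−1,0)` onto `(0,1)` by `x ↦ −x` (rule 2; the integrand is even),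
merge the two copies into `[(0,1), 4(1 − x⁴)^{b−1}]` (rule 1b), and substitute `t = x⁴` (rule 2,
`|dt/dx| = 4x³`): `4(1 − x⁴)^{b−1} = (x⁴)^{−3/4}(1 − x⁴)^{b−1} · 4x³`.
[cite: KontsevichZagier2001, §1.2] -/
theorem symmetricQuartic_equivalent (b : ℚ) (p ρ : IntegralRep 1)
    (hpd : p.domain = {x | x 0 ^ 4 ≤ 1})
    (hpi : Set.EqOn p.integrand (fun x => 2 * (1 - (x 0) ^ 4) ^ ((b:ℝ) - 1)) p.domain)
    (hρd : ρ.domain = {x | x 0 ∈ Set.Ioo (0:ℝ) 1})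
    (hρi : Set.EqOn ρ.integrand
      (fun x => (x 0) ^ (((1/4:ℚ):ℝ) - 1) * (1 - x 0) ^ ((b:ℝ) - 1)) ρ.domain) :
    Equivalent p ρ := by
  have hneg_sub : {x : Fin 1 → ℝ | x 0 ∈ Set.Ioo (-1:ℝ) 0} ⊆ p.domain := fun x hx => by
    rw [hpd]
    exact (pow_four_le_one_iff _).2 ⟨hx.1.le, hx.2.le.trans zero_le_one⟩
  have hpos_sub : {x : Fin 1 → ℝ | x 0 ∈ Set.Ioo (0:ℝ) 1} ⊆ p.domain := fun x hx => by
    rw [hpd]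
    exact (pow_four_le_one_iff _).2 ⟨by linarith [hx.1], hx.2.le⟩
  have hUsa := isSemialgebraic_negIoo.union isSemialgebraic_posIoo
  have hU_sub := union_subset hneg_sub hpos_sub
  obtain ⟨pn, hpnd, hpni⟩ : ∃ s : IntegralRep 1, s.domain = {x | x 0 ∈ Set.Ioo (-1:ℝ) 0} ∧
      s.integrand = p.integrand := ⟨p.restrict _ isSemialgebraic_negIoo hneg_sub, rfl, rfl⟩
  obtain ⟨pp, hppd, hppi⟩ : ∃ s : IntegralRep 1, s.domain = {x | x 0 ∈ Set.Ioo (0:ℝ) 1} ∧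
      s.integrand = p.integrand := ⟨p.restrict _ isSemialgebraic_posIoo hpos_sub, rfl, rfl⟩
  -- (1) the null points `x = 0, ±1`
  have h1 : of p - of (p.restrict _ hUsa hU_sub) ∈ relations := by
    refine p.of_sub_of_restrict_mem_relations hUsa hU_sub
      (measure_mono_null (fun x hx => ?_) (measure_union_null (measure_union_null
        (volume_setOf_apply_eq_const 1 0 (-1)) (volume_setOf_apply_eq_const 1 0 0))
        (volume_setOf_apply_eq_const 1 0 1)))
    rw [hpd] at hx
    obtain ⟨hx4, h3⟩ := hx
    have hx1 : -1 ≤ x 0 ∧ x 0 ≤ 1 := (pow_four_le_one_iff (x 0)).1 hx4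
    simp only [mem_union, mem_setOf_eq, mem_Ioo, not_or, not_and, not_lt] at h3
    simp only [mem_union, mem_setOf_eq]
    rcases hx1.1.lt_or_eq with hl | hl
    · rcases lt_trichotomy (x 0) 0 with h | h | h
      · exact absurd (h3.1 hl) (not_le.2 h)
      · exact Or.inl (Or.inr h)
      · exact Or.inr (le_antisymm hx1.2 (h3.2 h))
    · exact Or.inl (Or.inl hl.symm)
  -- (2) domain additivity `(−1,0) ∪ (0,1)`
  have h2 : of (p.restrict _ hUsa hU_sub) - of pn - of pp ∈ relations := by
    refine domainAddRel_subset_relations ⟨1, _, pn, pp, by rw [hpnd, hppd]; rfl, ?_,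
      fun x _ => by rw [hpni]; rfl, fun x _ => by rw [hppi]; rfl, rfl⟩
    rw [hpnd, hppd]
    refine measure_mono_null (fun x hx => ?_) measure_empty
    simp only [mem_inter_iff, mem_setOf_eq, mem_Ioo] at hx
    linarith [hx.1.2, hx.2.1]
  -- (3) fold `(−1,0)` onto `(0,1)` by `x ↦ −x`
  have h3 : of pn - of pp ∈ relations := by
    refine of_sub_of_mem_relations_of_neg ?_ fun x hx => ?_
    · rw [hpnd, hppd]
      ext y
      simp only [mem_setOf_eq, mem_Ioo, mem_image]
      refine ⟨fun ⟨h0, h1⟩ => ⟨-y, ⟨by simp; linarith, by simp; linarith⟩, neg_neg y⟩, ?_⟩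
      rintro ⟨x, ⟨h0, h1⟩, rfl⟩
      exact ⟨by simp; linarith, by simp; linarith⟩
    · rw [hpnd] at hx
      have hx' : x ∈ p.domain := hneg_sub hx
      have hnx : -x ∈ p.domain := hpos_sub (by
        simp only [mem_setOf_eq, mem_Ioo, Pi.neg_apply]
        exact ⟨by linarith [hx.2], by linarith [hx.1]⟩)
      rw [hpni, hppi, hpi hx', hpi hnx]
      simp only [Pi.neg_apply]
      rw [show (-x 0) ^ 4 = (x 0) ^ 4 by ring]
  -- (4) merge the two copies: `D = [(0,1), 2f]`
  obtain ⟨D, hDd, hDi⟩ : ∃ D : IntegralRep 1, D.domain = {x | x 0 ∈ Set.Ioo (0:ℝ) 1} ∧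
      D.integrand = fun x => 2 * p.integrand x := by
    refine ⟨⟨_, _, isSemialgebraic_posIoo, ?_, (p.integrableOn.mono_set hpos_sub).const_mul 2⟩,
      rfl, rfl⟩
    exact (IsSemialgebraicFunOn.mul_holds (isSemialgebraicFunOn_natCast isSemialgebraic_posIoo 2)
      (p.isSemialgebraicFunOn_integrand.mono hpos_sub isSemialgebraic_posIoo)).congr
      fun x _ => by simp
  have h4 : of D - of pp - of pp ∈ relations := by
    refine integrandAddRel_subset_relations ⟨1, D, pp, pp, by rw [hppd, hDd], by rw [hppd, hDd],
      fun x _ => ?_, rfl⟩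
    simp only [hDi, hppi, Pi.add_apply]
    ring
  -- (5) `t = x⁴`
  have h5 : of D - of ρ ∈ relations := by
    refine of_sub_of_mem_relations_of_boxDilation (0 : Fin 1) 3 (fun x hx => ?_) ?_ (fun x hx => ?_)
    · rw [hDd] at hx
      exact hx.1
    · rw [hρd, hDd]
      ext y
      simp only [mem_setOf_eq, mem_Ioo, mem_image]
      constructor
      · rintro ⟨h0, h1⟩
        refine ⟨fun _ => (y 0) ^ ((4:ℝ)⁻¹), ⟨Real.rpow_pos_of_pos h0 _,
          Real.rpow_lt_one h0.le h1 (by norm_num)⟩, ?_⟩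
        funext i
        rw [Fin.fin_one_eq_zero i, boxDilation_apply_self]
        show (y 0 ^ ((4:ℝ)⁻¹)) ^ 4 = y 0
        exact Real.rpow_inv_natCast_pow h0.le (by norm_num)
      · rintro ⟨x, ⟨h0, h1⟩, rfl⟩
        rw [boxDilation_apply_self]
        exact ⟨by positivity, pow_lt_one₀ h0.le h1 (by norm_num)⟩
    · rw [hDd] at hx
      have hx0 : 0 < x 0 := hx.1
      have hxp : x ∈ p.domain := hpos_sub hx
      have hbx : boxDilation 0 3 x ∈ ρ.domain := by
        rw [hρd]
        show boxDilation 0 3 x 0 ∈ Set.Ioo (0:ℝ) 1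
        rw [boxDilation_apply_self]
        exact ⟨by positivity, pow_lt_one₀ hx0.le hx.2 (by norm_num)⟩
      rw [hDi]
      dsimp only
      rw [hpi hxp, hρi hbx]
      dsimp only
      rw [boxDilation_apply_self]
      have e1 : (x 0 ^ (3 + 1)) ^ (((1/4:ℚ):ℝ) - 1) = (x 0 ^ 3)⁻¹ := by
        rw [← Real.rpow_natCast (x 0) (3 + 1), ← Real.rpow_mul hx0.le, ← Real.rpow_neg_one,
          ← Real.rpow_natCast (x 0) 3, ← Real.rpow_mul hx0.le]
        norm_num
      rw [e1]
      have hx3 : x 0 ^ 3 ≠ 0 := pow_ne_zero 3 hx0.ne'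
      push_cast
      field_simp
      ring
  have : of p - of ρ = (of p - of (p.restrict _ hUsa hU_sub)) +
      (of (p.restrict _ hUsa hU_sub) - of pn - of pp) + (of pn - of pp) - (of D - of pp - of pp) +
      (of D - of ρ) := by abel
  rw [Equivalent, this]
  exact relations.add_mem (relations.sub_mem (relations.add_mem (relations.add_mem h1 h2) h3) h4) h5

/-- The base `{x⁴ ≤ 1} ⊆ ℝ¹` of the quartic stones is `ℚ`-semialgebraic. [folklore] -/
theorem isSemialgebraic_quarticBase : IsSemialgebraic ℚ {x : Fin 1 → ℝ | x 0 ^ 4 ≤ 1} := by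
  have h := isSemialgebraic_setOf_eval_le (k := ℚ) (R := ℝ) (X 0 ^ 4 : MvPolynomial (Fin 1) ℚ) (C 1)
  simpa only [map_pow, MvPolynomial.aeval_X, MvPolynomial.aeval_C, map_one] using h

/-- **The area of a quartic stone is a Beta class.** For `1 < b`, any representation `[S_b, 1]` on
the stone `S_b = {x⁴ ≤ 1, |y| ≤ (1 − x⁴)^{b−1}}` (integrand `1` on it) has class `β(1/4, b)` in `P`:
one Newton–Leibniz move along `y` with primitive `y` (`InverseLandau.tateLifting_bandArea`; the
half-width is `ℚ`-semialgebraic as a rational power of a non-negative polynomial) gives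
`[{x⁴ ≤ 1}, 2(1 − x⁴)^{b−1}]`, and `symmetricQuartic_equivalent` turns it into `β(1/4, b)`.
[cite: KontsevichZagier2001, §1.2 rules (2), (3)] -/
theorem toFormalPeriod_quarticStone (b : ℚ) (hb : 1 < b) (r : IntegralRep 2)
    (hrd : r.domain = {z | z 0 ^ 4 ≤ 1 ∧ -(1 - z 0 ^ 4) ^ ((b:ℝ) - 1) ≤ z 1 ∧
      z 1 ≤ (1 - z 0 ^ 4) ^ ((b:ℝ) - 1)})
    (hr1 : ∀ x ∈ r.domain, r.integrand x = 1) :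
    toFormalPeriod (of r) = betaClass (1/4) b := by
  have h14 : (0:ℚ) < 1/4 := by norm_num
  have hb0 : 0 < b := by linarith
  -- the half-width of the band over the base `{x⁴ ≤ 1}`
  have hβ : IsSemialgebraicFunOn ℚ {x : Fin 1 → ℝ | x 0 ^ 4 ≤ 1}
      (fun x => (1 - x 0 ^ 4) ^ ((b:ℝ) - 1)) := by
    have hf : IsSemialgebraicFunOn ℚ {x : Fin 1 → ℝ | x 0 ^ 4 ≤ 1} (fun x => 1 - x 0 ^ 4) :=
      (isSemialgebraicFunOn_aeval isSemialgebraic_quarticBase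
        (1 - X 0 ^ 4 : MvPolynomial (Fin 1) ℚ)).congr fun x _ => by
          simp only [map_sub, map_one, map_pow, MvPolynomial.aeval_X]
    exact (hf.rpow_ratCast_of_nonneg (fun x hx => sub_nonneg.2 hx)
      (sub_ne_zero.2 (ne_of_gt hb))).congr fun x _ => by simp only [Rat.cast_sub, Rat.cast_one]
  have hle : ∀ x ∈ {x : Fin 1 → ℝ | x 0 ^ 4 ≤ 1},
      -(1 - x 0 ^ 4) ^ ((b:ℝ) - 1) ≤ (1 - x 0 ^ 4) ^ ((b:ℝ) - 1) := fun x hx =>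
    neg_le_self (Real.rpow_nonneg (sub_nonneg.2 hx) _)
  obtain ⟨p, hpd, hpi, hA⟩ := InverseLandau.tateLifting_bandArea 1 r {x | x 0 ^ 4 ≤ 1}
    (fun x => -(1 - x 0 ^ 4) ^ ((b:ℝ) - 1)) (fun x => (1 - x 0 ^ 4) ^ ((b:ℝ) - 1))
    isSemialgebraic_quarticBase hβ.neg hβ hle (by rw [hrd]; rfl) (fun x hx => hr1 x hx)
  -- the symmetric quartic fold
  have hB : Equivalent p (betaRep (1/4) b h14 hb0) :=
    symmetricQuartic_equivalent b p _ hpd (fun x _ => by rw [hpi]; ring)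
      (by rw [betaRep_domain, unitIoo_eq_setOf]) (fun _ _ => rfl)
  rw [betaClass_eq _ _ h14 hb0]
  exact (toFormalPeriod_eq_iff.mpr hA).trans hB.toFormalPeriod_eq

/-! ## The Fermat stone: dilation onto the unit Fermat stone -/

/-- **The unit Fermat stone with integrand `1` is an honest representation**: `{x⁴ + y⁴ ≤ 1}` is
`ℚ`-semialgebraic and bounded (inside `[−1,1]²`), so the constant `1` is integrable on it.
[folklore] -/
theorem exists_fermatRep : ∃ F : IntegralRep 2,
    F.domain = {v : Fin 2 → ℝ | v 0 ^ 4 + v 1 ^ 4 ≤ 1} ∧ F.integrand = fun _ => 1 := by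
  have hF : IsSemialgebraic ℚ {v : Fin 2 → ℝ | v 0 ^ 4 + v 1 ^ 4 ≤ 1} := by
    have h := isSemialgebraic_setOf_eval_le (k := ℚ) (R := ℝ)
      (X 0 ^ 4 + X 1 ^ 4 : MvPolynomial (Fin 2) ℚ) (C 1)
    simpa only [map_add, map_pow, MvPolynomial.aeval_X, MvPolynomial.aeval_C, map_one] using h
  have hsub : {v : Fin 2 → ℝ | v 0 ^ 4 + v 1 ^ 4 ≤ 1} ⊆ Set.pi univ fun _ => Icc (-1:ℝ) 1 := by
    intro v hv
    have h : v 0 ^ 4 + v 1 ^ 4 ≤ 1 ∧ 0 ≤ v 0 ^ 4 ∧ 0 ≤ v 1 ^ 4 := ⟨hv, by positivity, by positivity⟩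
    simp only [mem_univ_pi, Fin.forall_fin_two, mem_Icc]
    exact ⟨(pow_four_le_one_iff _).1 (by linarith), (pow_four_le_one_iff _).1 (by linarith)⟩
  have hvol : volume {v : Fin 2 → ℝ | v 0 ^ 4 + v 1 ^ 4 ≤ 1} ≠ ⊤ :=
    ((measure_mono hsub).trans_lt (isCompact_univ_pi fun _ => isCompact_Icc).measure_lt_top).ne
  exact ⟨⟨_, fun _ => 1, hF, (isSemialgebraicFunOn_natCast hF 1).congr fun _ _ => by simp,
    integrableOn_const hvol⟩, rfl, rfl⟩

/-- **The dilation move for the Fermat stone** (rule (2) along `u ↦ c • u`, `c = (8/9)^{1/4}`,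
Jacobian `c²`): `[{x⁴ + y⁴ ≤ 1}, c²] − [{x⁴ + y⁴ ≤ 8/9}, 1] ∈ KZ.relations`
(`KZ.smul_sub_mem_relations`). [cite: KontsevichZagier2001, §1.2 rule (2)] -/
theorem fermat_dilation (F r' : IntegralRep 2)
    (hFd : F.domain = {v : Fin 2 → ℝ | v 0 ^ 4 + v 1 ^ 4 ≤ 1}) (hFi : F.integrand = fun _ => 1)
    (hr'd : r'.domain = {v : Fin 2 → ℝ | v 0 ^ 4 + v 1 ^ 4 ≤ 8 / 9})
    (hr'1 : ∀ x ∈ r'.domain, r'.integrand x = 1) :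
    of (F.constMul ((((8:ℝ)/9) ^ ((4:ℝ)⁻¹)) ^ 2) (isAlgebraic_fermatConst.pow 2)) - of r' ∈
      relations := by
  set c : ℝ := ((8:ℝ)/9) ^ ((4:ℝ)⁻¹) with hc
  have hc0 : 0 < c := Real.rpow_pos_of_pos (by norm_num) _
  have hc4 : c ^ 4 = 8/9 := fermatConst_pow_four
  have hsmul : ∀ u : Fin 2 → ℝ, (c • u) 0 ^ 4 + (c • u) 1 ^ 4 = 8/9 * (u 0 ^ 4 + u 1 ^ 4) :=
    fun u => by simp only [Pi.smul_apply, smul_eq_mul, mul_pow, hc4]; ring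
  have hmaps : ∀ u ∈ F.domain, c • u ∈ r'.domain := fun u hu => by
    rw [hFd] at hu
    have hu' : u 0 ^ 4 + u 1 ^ 4 ≤ 1 := hu
    rw [hr'd, mem_setOf_eq, hsmul]
    linarith
  refine smul_sub_mem_relations isAlgebraic_fermatConst hc0.ne' _ r' ?_ fun u hu => ?_
  · refine Set.ext fun v => ⟨fun hv => ⟨c⁻¹ • v, ?_, by show c • c⁻¹ • v = v; rw [smul_inv_smul₀
      hc0.ne']⟩, fun ⟨u, hu, huv⟩ => huv ▸ hmaps u hu⟩
    rw [hr'd] at hv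
    have hv' : v 0 ^ 4 + v 1 ^ 4 ≤ 8/9 := hv
    have h := hsmul (c⁻¹ • v)
    rw [smul_inv_smul₀ hc0.ne'] at h
    rw [IntegralRep.domain_constMul, hFd]
    show (c⁻¹ • v) 0 ^ 4 + (c⁻¹ • v) 1 ^ 4 ≤ 1
    linarith
  · rw [IntegralRep.integrand_constMul, hFi, hr'1 _ (hmaps u hu), abs_of_pos hc0]
    ring

/-! ## Beta algebra in `P` and the theorem -/

/-- **`β(1/4, 3/2) = κ((8/9)^{1/2}) · β(1/4, 5/4)` in `P`**: from the two translations
`κ(1/2)β(1/4,1/2) = κ(3/4)β(1/4,3/2)` and `κ(1/4)β(1/4,1/4) = κ(1/2)β(1/4,5/4)`, the duplication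
`β(1/4,1/4) = κ(2^{1/2})β(1/2,1/4)` (landed `DuplicationFamily`), the reflection
`β(1/2,1/4) = β(1/4,1/2)`, the constant identity `(3/4)·(8/9)^{1/2}·(1/4)·2^{1/2} = (1/2)²` and the
invertibility of `κ(3/4)`, `κ(1/2)`. [cite: AndrewsAskeyRoy1999, §1.1, Thm 1.5.1] -/
theorem betaClass_quarter_threeHalves_eq :
    betaClass (1/4) (3/2) = kap ((((8:ℝ)/9) ^ ((4:ℝ)⁻¹)) ^ 2) (isAlgebraic_fermatConst.pow 2) *
      betaClass (1/4) (5/4) := by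
  have h14 : (0:ℚ) < 1/4 := by norm_num
  -- translation `κ(1/2)β(1/4,1/2) = κ(3/4)β(1/4,3/2)`
  have T1 := kap_mul_betaClass_eq_kap_mul_betaClass_succ (1/4) (1/2) h14 (by norm_num)
  rw [show (1/4 + 1/2 : ℚ) = 3/4 by norm_num, show (1/2 + 1 : ℚ) = 3/2 by norm_num] at T1
  -- translation `κ(1/4)β(1/4,1/4) = κ(1/2)β(1/4,5/4)`
  have T2 := kap_mul_betaClass_eq_kap_mul_betaClass_succ (1/4) (1/4) h14 h14
  rw [show (1/4 + 1/4 : ℚ) = 1/2 by norm_num, show (1/4 + 1 : ℚ) = 5/4 by norm_num] at T2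
  -- duplication `β(1/4,1/4) = κ(2^{1/2}) β(1/4,1/2)`
  have D := duplication_betaClass duplicationFamily_proof (1/4) h14 (isAlgebraic_dupConst (1/4))
  rw [betaClass_symm (1/2) (1/4) (by norm_num) h14] at D
  -- constants
  have hK : kap _ (isAlgebraic_ratCast (3/4)) * kap _ (isAlgebraic_fermatConst.pow 2) *
      kap _ (isAlgebraic_ratCast (1/4)) * kap _ (isAlgebraic_dupConst (1/4)) =
      kap _ (isAlgebraic_ratCast (1/2)) * kap _ (isAlgebraic_ratCast (1/2)) := by
    rw [← kap_mul, ← kap_mul, ← kap_mul, ← kap_mul]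
    exact kap_congr _ _ const_identity
  have hu1 : kap _ (isAlgebraic_ratCast (3/4)) * kap _ (isAlgebraic_ratCast (3/4)).inv = 1 :=
    kap_mul_kap_inv _ (by norm_num)
  have hu2 : kap _ (isAlgebraic_ratCast (1/2)) * kap _ (isAlgebraic_ratCast (1/2)).inv = 1 :=
    kap_mul_kap_inv _ (by norm_num)
  linear_combination kap _ (isAlgebraic_ratCast (3/4)).inv * kap _ (isAlgebraic_ratCast (1/2)).inv *
    (-kap _ (isAlgebraic_ratCast (1/2)) * T1 +
      kap _ (isAlgebraic_ratCast (3/4)) * kap _ (isAlgebraic_fermatConst.pow 2) * T2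
      - kap _ (isAlgebraic_ratCast (3/4)) * kap _ (isAlgebraic_fermatConst.pow 2) *
        kap _ (isAlgebraic_ratCast (1/4)) * D
      - betaClass (1/4) (1/2) * hK)
    + (betaClass (1/4) (3/2) - kap _ (isAlgebraic_fermatConst.pow 2) * betaClass (1/4) (5/4)) *
      (-(kap _ (isAlgebraic_ratCast (1/2)) * kap _ (isAlgebraic_ratCast (1/2)).inv) * hu1 - hu2)

/-- **`FermatQuarticStone`** (route WeightFloor, stmt-KontsevichZagierPeriods-13936): the quartic
egg `{x⁴ + y² ≤ 1}` and the Fermat stone `{x⁴ + y⁴ ≤ 8/9}`, both with integrand `1`, are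
KZ-equivalent.
Proof: in the formal period ring `⟦r⟧ = β(1/4,3/2)` and `⟦r'⟧ = κ((8/9)^{1/2})β(1/4,5/4)` (one
Newton–Leibniz band move, the symmetric quartic fold, one dilation), these classes agree by
`betaClass_quarter_threeHalves_eq`, and `KZ.toFormalPeriod_eq_iff` gives `KZ.Equivalent r r'`.
[cite: KontsevichZagier2001, §1.2] -/
theorem fermatQuarticStone_proof :
    Summit.KontsevichZagierPeriods.KontsevichZagierPeriods.Theses.WeightFloor.FermatQuarticStone := by
  intro r r' hrd hr1 hr'd hr'1
  -- `⟦r⟧ = β(1/4, 3/2)`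
  have hA : toFormalPeriod (of r) = betaClass (1/4) (3/2) :=
    toFormalPeriod_quarticStone (3/2) (by norm_num) r
      (by rw [hrd]; exact setOf_quarticStone_eq two_ne_zero even_two _ (by norm_num)) hr1
  -- `⟦r'⟧ = κ(c²) · β(1/4, 5/4)` through the unit Fermat stone
  obtain ⟨F, hFd, hFi⟩ := exists_fermatRep
  have hF : toFormalPeriod (of F) = betaClass (1/4) (5/4) :=
    toFormalPeriod_quarticStone (5/4) (by norm_num) F
      (by rw [hFd]; exact setOf_quarticStone_eq (by norm_num) (by decide) _ (by norm_num))
      (fun x _ => by rw [hFi])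
  have hB : toFormalPeriod (of r') =
      kap _ (isAlgebraic_fermatConst.pow 2) * betaClass (1/4) (5/4) := by
    rw [← hF, kap_mul_toFormalPeriod]
    exact (toFormalPeriod_eq_iff.mpr (fermat_dilation F r' hFd hFi hr'd hr'1)).symm
  exact toFormalPeriod_eq_iff.mp (hA.trans (betaClass_quarter_threeHalves_eq.trans hB.symm))

end Summit.KontsevichZagierPeriods.WeightFloor

end
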